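import Mathlib
import HarnessLib
import HarnessLib.Audit
import Summits.AtomisticToContinuum.Statement
import Literature.Barriers.AtomisticToContinuum.MacroErgodicityHypothesis

/-!
Route: ParityLiouville

CLOSED (retired) 2026-08-15T13:45:23Z by operator:999:1257524 — reason: not-a-thesis: assembly does not conclude the sub-problem Statement — note: D-0027 §2.1 audit (human 2026-08-15: routes that do not decide the summit are removed): the assembly concludes `BoundaryThermalisation`, not the sub-problem statement; a NEW conforming route may be opened from the same idea (generated `closes : … → _root_.FouriersLaw`).. The file is kept as the record of this route; refuted decls are indexed as negative knowledge (`ledger negatives`).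

# Route ParityLiouville — odd-sector macro-ergodicity + bulk window compactness + momentum parity
give the anti-ballistic rung J_N → 0 (a Liouville theorem for heat)

RUNG ROUTE realising idea card macro-ergodicity-parity-antiballistic (its deduction M3 → P1; a
partial-result engine, NOT a proof of the
conjunct — no assembly to FouriersLaw is claimed, exactly as for the sibling rung route
SingleThermostatRigidity whose target decl
BoundaryThermalisation (stmt-3255) this route shares). X = X_R ∧ X_E ∧ X_T ("it suffices to show"):
X_R (ZeroCurrentRigidity, shared with LocalOhmRigidity stmt-2739) every shift-invariant,
time-invariant (∫𝒜f dν = 0), regular probability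
measure of the INFINITE deterministic pinned chain carries zero mean bond current — the odd sector
of the catalogued
MacroErgodicityHypothesis (support ZeroCurrentOfMacroErgodic: hypothesis ⇒ X_R by momentum parity, j
odd / Gibbs kernels even);
X_E (NessRegularity, new) the steady states of the N-chain have box relative entropies ≤ C·|Λ|
w.r.t. one shift-invariant Gibbs
reference, uniformly in N and in the position of the box; X_T (NessTightness, shared stmt-3257) N-
and site-uniform moments.
Then (support CesaroUpgrade) X_R upgrades by Cesàro averaging over shifts to LIOUVILLE FOR HEAT:
every time-invariant,
translation-BOUNDED, uniformly regular state has zero current; (support WindowLimit) if J̃_N ↛ 0,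
bulk windows of the NESS converge
along a subsequence to such a state with current lim J̃_N ≠ 0 — contradiction; (support
ExactBalance, shared stmt-3259) J̃ = γ(T_L − ⟨p_0²⟩)
turns J̃_N → 0 into contact thermalisation. Target: BoundaryThermalisation for every steady family
at fixed T_L ≠ T_R.
Lean: `NessTightness ∧ NessRegularity ∧ ZeroCurrentRigidity` (route decls, namespace
Summit.AtomisticToContinuum.FouriersLaw.Theses.ParityLiouville; each a one-line Prop over existing
declarations, rc 0 in the planner's Sketch.lean, where moreover `theorem assembly_holds : Assembly`
is PROVED sorry-free — the glue is pure real analysis)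

## Assembly
Glue PROVED by the planner (theorem assembly_holds : Assembly, sorry-free, rc 0 in Sketch.lean, ~70
lines of real analysis): fix
parameters > 0, T_L, T_R > 0 and a steady family μ. NessTightness/NessRegularity instantiate the two
a-priori hypotheses of WindowLimit
for this family; CesaroUpgrade ZeroCurrentRigidity : LiouvilleForHeat. If totalCurrent(μ_N)/(N−1) ↛
0, Metric.tendsto_atTop gives ε > 0
with ∃ᶠ N, ε ≤ |J̃_N|; WindowLimit yields ν with ε ≤ |∫ j_0 dν| while LiouvilleForHeat gives ∫ j_0
dν = 0 — contradiction. ExactBalance at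
N+2 (moments from NessTightness) rewrites J̃_{N+2} = γ(T_L − ⟨p_0²⟩_{N+2}) = γ(⟨p²_last⟩_{N+2} −
T_R), so both contact temperatures converge
(field_simp; Filter.tendsto_add_atTop_iff_nat reindexing). ZeroCurrentOfMacroErgodic and
LiouvilleForHeat are carried as the link to the
catalogued hypothesis and as the stand-alone deliverable (formally unused by the glue).

Rationale: WHY THIS LINE. Nobody can prove even J̃_N → 0 for a deterministic anharmonic bulk
(BonettoLebowitzReyBellet2000 §6.3, §9; Bernardin2014 §2); the
card's observation is that the catalogued open input of hydrodynamic limits, macro-ergodicity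
(Bernardin2014 Def. 1,
FritzFunakiLebowitz1994), already PAYS at this qualitative rung through its odd sector alone and
without any hydrodynamic limit,
one-block estimate or sector condition: in a time-invariant state the mean current is
bond-independent (continuity equation), so it
survives Cesàro averaging over translations, and it vanishes in every Gibbs mixture by p ↦ −p parity
— hence "no steady heat flux
through an infinite thermalising medium" (LiouvilleForHeat), the sharp separatrix violated exactly
by the harmonic member
(SpohnLebowitz1977: translation-invariant Gaussian stationary states with a heat flux "through every
point", and §7(iii) the printed
EXPECTATION that anharmonic crystals have none). The passage NESS ⇒ infinite-volume stationary state
⇒ characterisation is the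
Eyink–Lebowitz–Spohn architecture (EyinkLebowitzSpohn1991, stochastic lattice gases;
BernardinOlla2011 Thm 3 for the velocity-flip
chain), transplanted to BULK windows of the deterministic chain with the tree's generator-form
IsTimeInvariant (LanfordLebowitzLieb1977
cylinder calculus) and Mathlib's klDiv regularity. Imported areas: infinite-volume ergodic theory of
Hamiltonian systems
(Gibbs-characterisation programme: FritzFunakiLebowitz1994, LiveraniOlla1996, Gurevich–Sukhov
doi:10.1007/bf01609838), weak
compactness / relative-entropy lower semicontinuity (KipnisLandim1999), none of it physical analogy.
Versus prior routes:
SingleThermostatRigidity reaches the same target from the HALF-line seen from one bath (crux: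
single-thermostat no-flux);
LocalOhmRigidity uses the same X_R only as the rigidity input of a LINEARISED local Ohm law aimed at
HasBoundedResponse; this route
is the bath-free whole-line twin, the only one in which the catalogued hypothesis is a sufficient
engine verbatim, and it files
the N-uniform NESS REGULARITY (entropy, not moments) as a typed crux for the first time. Negatives
index: empty at filing.

RANKED CRUXES. #0 BoundaryThermalisation (target) — for pinnedChain ω₂ lam β γ (all > 0), T_L, T_R >
0 and EVERY family (μ_N) of weak steady states: ⟨p_0²⟩_{μ_{N+1}} → T_L, ⟨p²_last⟩_{μ_{N+1}} → T_R
and J̃_N = totalCurrent(μ_N)/(N−1) → 0 (identical to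
SingleThermostatRigidity.BoundaryThermalisation, stmt-3255 — shared decl; the card's AntiBallistic ∧
ContactThermalisation). (why it might fail: Inherits the cruxes: a radiating regular state of the
infinite anharmonic chain (hidden odd charge, KAM debris), N-growing NESS moments or entropies
(energy/entropy piling up in a Hamiltonian bulk), or non-thermalising dilute radiation would break
it.) [BonettoLebowitzReyBellet2000, SpohnLebowitz1977, BernardinOlla2011, AokiKusnezov2001]
#2 ZeroCurrentRigidity (crux) — ODD-SECTOR MACRO-ERGODICITY (identical to
LocalOhmRigidity.ZeroCurrentRigidity, stmt-2739 — shared decl): for ω₂, lam, β > 0 every probability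
measure on (ℝ×ℝ)^ℤ that is shift-invariant, time-invariant in generator form (IsTimeInvariant) and
regular (IsRegular), with j_0 integrable, has ∫ j_0 dν = 0. Implied by MacroErgodicityHypothesis
(support ZeroCurrentOfMacroErgodic); false at lam = β = 0 (SpohnLebowitz1977). Card items M3/M4 (the
rigidity heart; rank 2 here because it is the informative step: its refutation = a radiating state
of a deterministic anharmonic chain). [difficulty: open-problem] (why it might fail: Regular
current-carrying invariant states may exist without integrability: KAM/breather families (FFL1994
p.215) or a hidden quasi-local odd conserved charge (Mazur); open for every anharmonic chain, and
'regular' does not exclude currents (harmonic case).) [FritzFunakiLebowitz1994, Bernardin2014,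
SpohnLebowitz1977, LiveraniOlla1996, Mazur1969, Zotos2002]
#3 NessRegularity (crux) — N-UNIFORM REGULARITY OF THE NESS (card item M2; new typed crux): for
pinnedChain (all parameters > 0) and T_L, T_R > 0 there are a temperature T > 0, a SHIFT-INVARIANT
infinite-volume Gibbs state μ_T of the chain and C < ∞ such that for every N, every weak steady
state μ of the N-chain and every box Λ = {a, …, a+n} ⊆ {0, …, N−1}: H(μ|_Λ ‖ μ_T|_Λ) ≤ C·(n+1)
(Mathlib klDiv of the box marginals). The entropy twin of NessTightness: what makes window limits
IsRegular, hence inside the scope of macro-ergodicity. Expected via entropy balance (production = γΣ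
T_α × relative Fisher information at the baths, EckmannPilletReyBellet1999b) + a dimension-free
log-Sobolev inequality for the uniformly log-concave Gibbs reference + control of Fisher information
in the bulk; stochastic precedent BernardinOlla2005 (entropy of the NESS relative to local
equilibrium, harmonic chain + conservative noise). [difficulty: XL] (why it might fail: No N-uniform
a priori estimate exists for a Hamiltonian-bulk NESS; entropy needs bulk Fisher-information control
= quantitative hypoellipticity uniform in N, exactly what is missing (Villani2009 §9.2,
BeckerMenegaki2022); a singular exotic weak steady state (NessUnique open) gives klDiv = ∞.)
[Bernardin2014, EckmannPilletReyBellet1999b, BernardinOlla2005, BonettoLebowitzReyBellet2000,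
Villani2009, BeckerMenegaki2022]
#4 NessTightness (crux) — N- AND SITE-UNIFORM MOMENT BOUNDS (identical to
SingleThermostatRigidity.NessTightness, stmt-3257 — shared decl; card item M1): for all parameters >
0, T_L, T_R > 0 and every m there is C with ∫ (|q_i|^m + |p_i|^m) dμ ≤ C for every N, every weak
steady state μ of the N-chain and every site i. Supplies tightness and uniform integrability (forces
are cubic, currents quartic) for WindowLimit and the moments ExactBalance needs. [difficulty: L]
(why it might fail: No N-uniform moment bound is known for any Hamiltonian-bulk chain (Bernardin2014
§2: 'polynomial in N'); Lyapunov constants of CEHR2018 grow with N; stiff pinning heats tails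
(Hairer2009), pinnedChain is the borderline degree 4 = 4.) [Bernardin2014,
CuneoEckmannHairerReyBellet2018, Hairer2009, HairerMattingly2009, EckmannPilletReyBellet1999b,
BonettoLebowitzReyBellet2000]
#9 LiouvilleForHeat (support) — LIOUVILLE THEOREM FOR HEAT (the card's M3, stand-alone deliverable;
closed by CesaroUpgrade + ZeroCurrentRigidity or directly): for ω₂, lam, β > 0, every probability
measure ν on (ℝ×ℝ)^ℤ that is time-invariant (IsTimeInvariant), translation-BOUNDED (all polynomial
site moments bounded uniformly in the site) and uniformly regular (box relative entropies ≤ C(n+1)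
w.r.t. one shift-invariant Gibbs state), with j_0 integrable, has ∫ j_0 dν = 0 — NOT assuming
shift-invariance of ν. 'Heat cannot flow steadily through an infinite thermalising medium'; false
for the harmonic chain (SpohnLebowitz1977 radiating states), printed as an expectation for
anharmonic crystals (SpohnLebowitz1977 §7 (iii)). [difficulty: open-problem] [SpohnLebowitz1977,
FritzFunakiLebowitz1994, Bernardin2014]
#9 CesaroUpgrade (support) — GLUE (provable, ~1–2 weeks of Lean): ZeroCurrentRigidity →
LiouvilleForHeat. Given ν as in LiouvilleForHeat, ν_n := n⁻¹Σ_{k<n} (shift^k)_*ν is time-invariant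
(liouvilleZ commutes with shift; the test class IsLocalTestFunction is shift-stable), has the same
site-uniform moments and — convexity of klDiv in the first argument, reference shift-invariant — the
same regularity constant; tightness (moments) gives a weak limit ν̄ along n_k: a shift-invariant
probability measure, time-invariant (uniform integrability of 𝒜f from moments of order > 3, forces
cubic), IsRegular (lower semicontinuity of klDiv box by box, fixed reference), j_0 ∈ L¹.
BOND-INDEPENDENCE: 𝒜e_k = j_{k−1} − j_k for the local energy e_k = p_k²/2 + U(q_k) + V(q_{k+1} −
q_k) (cut off through bounded C¹ functions φ_M(e_k), dominated convergence) gives ν(j_k) = ν(j_0)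
for all k, so ν̄(j_0) = ν(j_0); ZeroCurrentRigidity kills ν̄(j_0). [difficulty: M] [Bernardin2014,
KipnisLandim1999, LanfordLebowitzLieb1977]
#9 ZeroCurrentOfMacroErgodic (support) — PARITY (provable-now): MacroErgodicityHypothesis →
ZeroCurrentRigidity. Under the hypothesis ν = π.bind κ with κ_T Gibbs (IsGibbsMixture); ∫ j_0 dν =
∫(∫ j_0 dκ_T) dπ (integrability along the bind); for a DLR state κ_T the two-site kernel of
chainSpecification at {0,1} resamples (p_0, p_1) as centred Maxwellians independent of the positions
(cf. InfiniteChainGibbsMomenta.map_snd_eq_gaussianReal), and j_0 = −½(p_0 + p_1)V′(q_1 − q_0) is odd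
in (p_0, p_1), so ∫ j_0 dκ_T = 0. Makes the catalogued hypothesis a sufficient engine for crux 2
verbatim (planner one-liner zeroCurrent_of_hypothesis in Sketch.lean). [difficulty: provable-now]
[Bernardin2014, FritzFunakiLebowitz1994]
#9 WindowLimit (support) — BULK WINDOW COMPACTNESS (provable; no sign conditions needed): for any
real parameters and any family (μ_N) of weak steady states with site-uniform moments (the
NessTightness shape) and uniform regularity w.r.t. a shift-invariant Gibbs reference (the
NessRegularity shape), if for some ε > 0 frequently ε ≤ |totalCurrent(μ_N)/(N−1)|, then there is a
probability measure ν on (ℝ×ℝ)^ℤ that is time-invariant (IsTimeInvariant), translation-bounded,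
uniformly regular w.r.t. the same reference, with j_0 integrable and ε ≤ |∫ j_0 dν|. Proof: read μ_N
on windows centred at ⌊N/2⌋ (zero-padded push-forward to ChainConfig); Prokhorov; STATIONARITY
TRANSFER: for a local C¹ test f the bath terms of the generator do not touch bulk coordinates, so
L_N(f∘window) = (𝒜f)∘window, and ∫ L_N(f∘window·χ_M) dμ_N = 0 with smooth cutoffs χ_M (mollify f to
C^∞; let M → ∞ by dominated convergence at fixed N); pass N → ∞ by uniform integrability (moments >
3); regularity by lower semicontinuity of klDiv with the shift-invariant reference; all bond
currents of a steady state equal J̃_N (local energy balance with cutoffs), currents uniformly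
integrable (moments > 4), so ∫ j_0 dν = lim J̃_{N_k} with |lim| ≥ ε. [difficulty: M]
[EyinkLebowitzSpohn1991, LanfordLebowitzLieb1977, KipnisLandim1999, SpohnLebowitz1977]
#9 ExactBalance (support) — EXACT ENERGY BALANCE AT THE CONTACTS (identical to
SingleThermostatRigidity.ExactBalance, stmt-3259 — shared decl; provable): for the (N+2)-chain and a
weak steady state with all polynomial moments, totalCurrent μ = (N+1)γ(T_L − ∫p_0² dμ) =
(N+1)γ(∫p²_last dμ − T_R) (BLR (25)–(27): ∫L(p_0²/2 + U(q_0)) = 0, ∫L V(q_1−q_0) = 0, ∫L H = 0 with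
cutoffs). [difficulty: provable-now] [BonettoLebowitzReyBellet2000]

TWO-LAYER PLAN. Foreseen glued splits (nothing filed now): NessRegularity ⇐ BathFisherBudget
(entropy production identity: γΣT_α·I(μ_N|_{p_α} ‖ Maxwellian) =
σ_N ≤ J̃_N(1/T_R − 1/T_L), N-uniform) → BulkFisherNoPileUp (sitewise relative Fisher information of
μ_N w.r.t. the Gibbs reference bounded
uniformly in N and site; with the dimension-free LSI of the uniformly log-concave reference this
gives the box entropy bound) → NessRegularity
(k = 2). ZeroCurrentRigidity ⇐ NoLocalIntegrals (LocalOhmRigidity stmt-2744, shared kill test) →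
TiltStability (a regular space-time invariant
state with ν(j_0) ≠ 0 can be entropy-tilted into one violating a local conservation-law census / an
FFL-type exchangeability defect) →
ZeroCurrentRigidity (k = 2), or the FFL upgrade of the card (E1: reflection/exchange symmetry earned
from stationarity + regularity for the
quartic chain, FritzFunakiLebowitz1994 Thms 2.1–2.2 beyond bounded U″, V″). NessTightness ⇐
end-window bounds → bulk propagation (k = 2), shared
with SingleThermostatRigidity.

KILL CRITERIA. A shift-invariant, time-invariant, regular state of the infinite ANHARMONIC pinned
chain with non-zero mean current (¬ZeroCurrentRigidity;
e.g. from a hidden odd conserved charge — then Mazur makes the Green–Kubo integral diverge and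
FouriersLaw itself is in doubt, or from
KAM/breather debris that turns out regular) closes the route `refuted:ZeroCurrentRigidity` together
with LocalOhmRigidity's use of it, and is a
headline result. N-growing NESS box entropies (¬NessRegularity) with bounded moments forces a pivot
to a moments-only rigidity class (replace
'regular' by 'translation-bounded with finite entropy density' if such a version of X_R is credible)
or closes the route; N-growing moments
(¬NessTightness) kill this route and SingleThermostatRigidity alike. BoundaryThermalisation proved
via SingleThermostatRigidity moots the
target but not LiouvilleForHeat/ZeroCurrentRigidity, which stay wanted by LocalOhmRigidity and as
deliverables.

NOT DECOMPOSED YET. The card's further payoffs are deliberately NOT filed: P2 (partitioning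
protocol: the infinite chain started from Gibbs(T_L) ⊗ Gibbs(T_R) has
Cesàro-vanishing quench current — needs infinite-volume dynamics for a non-Gibbs initial law,
LanfordLebowitzLieb1977 Thm 3 only covers
Gibbs-a.e. data, plus regularity of the evolved states; printed as an expectation in
SpohnLebowitz1977 §7(iii)); P3 (bulk LTE up to mixture
from the full MacroErgodicityHypothesis); the engines E1 (FFL upgrade) / E2 (KMS-stability,
Aizenman–Goldstein–Gruber–Lebowitz–Martin) for the
hypothesis itself; E3 (measure rigidity) belongs to card macroergodicity-as-x2x3-rigidity. Also not
decomposed: the lower-semicontinuity /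
convexity API of klDiv under weak limits (provers attach it with --supports
WindowLimit/CesaroUpgrade), existence + shift-invariance of the
infinite-volume Gibbs state of pinnedChain (needed to inhabit NessRegularity's witness; DLR
uniqueness in d = 1), T-dependence of all constants
(allowed to blow up as T_L, T_R → 0: LowTemperatureWeakAnharmonicity).

CHEAPEST FALSIFIER. (1) Paper check, minutes: does 'regular' already kill currents? No — the
harmonic radiating states of SpohnLebowitz1977 are Gaussian with
spectral densities comparable to Gibbs, hence regular; so ZeroCurrentRigidity is genuinely
anharmonic (consistent, not a kill). (2) The
Levi–Yamilov integrability test of LocalOhmRigidity (NoLocalIntegrals, kit/sympy, an afternoon):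
canonical conservation-law conditions holding
at some (ω₂, lam, β) > 0 would produce tilted radiating Gibbs-like states and kill
ZeroCurrentRigidity there. (3) Numerics (kit MD, a day):
NESS of pinnedChain (ω₂=lam=β=γ=1, T_L=2, T_R=1, N = 32…512): estimate two-site box relative
entropies w.r.t. μ_T from histograms and the site
moments ⟨p_i⁴⟩, ⟨q_i⁴⟩; growth with N kills NessRegularity (resp. NessTightness) while leaving
LiouvilleForHeat intact. Not run here (plancard
budget; recorded for refuters).

NUMBERS. Harmonic calibration: J̃_N → c_∞(T_L − T_R) > 0 with flat bulk profile
(RiederLebowitzLieb1967; HarmonicChainBallisticFlux_holds in tree), so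
BoundaryThermalisation and ZeroCurrentRigidity both fail at lam = β = 0, as they must. Kinetic
regime: κ(T) ∼ (lam T)⁻² (AokiLukkarinenSpohn2006)
— constants in NessRegularity/NessTightness may degrade as T → 0. Items at open: 10 (1 target, 3
cruxes, 5 support, 1 assembly).

DEFINITION REQUESTS. None. Every constant exists:
OscillatorChain.IsSteadyState/totalCurrent/pinnedChain/PhaseSpace (FouriersLaw.lean),
ChainConfig/bondCurrentZ/
IsChainGibbsMeasure (InfiniteChainDynamics.lean),
IsShiftInvariant/IsTimeInvariant/IsRegular/boxMarginal/MacroErgodicityHypothesis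
(Barriers/AtomisticToContinuum/MacroErgodicityHypothesis.lean), InformationTheory.klDiv,
Fin.castLE/Fin.natAdd (Mathlib). The card's request
`bondCurrentZ` has already landed. Literature wanted (cite-only, not blocking): BernardinOlla2005
full text (acq-00023), EyinkLebowitzSpohn1991
(acq-02372).

Novelty: Searches (2026-08-15): `lit frontier AtomisticToContinuum --since 2020` (30 rows; relevant:
arXiv:2310.13338 Canestrari–Liverani–Olla heat
equation from deterministic dynamics with external chaotic forcing, arXiv:2604.14056 specific heat
of thermally driven chains — neither on
infinite-volume rigidity); `lit bridges AtomisticToContinuum --cross any` (30 rows, nothing on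
stationary states of infinite chains);
`lit search --hybrid "stationary non-equilibrium states infinite harmonic systems heat current
translation invariant"` (12 books; Spohn1991
pp.176–178 current-carrying stationary measures of driven lattice gases); crossref "stationary
non-equilibrium states of infinite harmonic
systems" (SpohnLebowitz1977 doi:10.1007/bf01614132; Boldrighini–Pellegrinotti–Triolo 1983
doi:10.1007/bf01010871); crossref "translation
invariant stationary states anharmonic chain zero energy current Gibbs" (0 relevant); zbMATH
"stationary measures infinite Hamiltonian
system Gibbs" (7: LiveraniOlla1996, Fritz–Liverani–Olla 1997 doi:10.1007/s002200050212,
Gurevich–Sukhov 1977 doi:10.1007/bf01609838,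
Dudnikova 2022/2023 harmonic field-crystal stationary non-equilibrium measures
doi:10.1134/s1064562422050106); `lit galaxy search --star
all` ×3 ("stationary non-equilibrium states of infinite harmonic systems": 0 rows; "macro-ergodic":
pdf/crabby 0, panama saturated;
"current-carrying stationary states": service saturated) — recorded; `lit read
doi:10.1007/bf01614132` pp.1, 22–23 READ; ELS1991 and
Be  [refs: 10.1007/bf01614132, 10.1007/bf01010871, 10.1007/s002200050212, 10.1007/bf01609838, 10.1134/s1064562422050106, 10.1007/bf01614132`, 10.1007/bf02099293, 2310.13338, 2604.14056, 1407.7023, doi:10.1007/bf01614132, doi:10.1007/bf01010871, doi:10.1007/s002200050212, doi:10.1007/bf01609838, doi:10.1134/s1064562422050106, doi:10.1007/bf02099293, Spohn1991, SpohnLebowitz1977, LiveraniOlla1996, BernardinOll]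

Barriers (technique_class: odd-sector-macro-ergodicity, window-compactness, parity): - technique_class: odd-sector-macro-ergodicity, window-compactness, parity
- Literature.Barriers.AtomisticToContinuum.MacroErgodicityBarrier: engaged head-on, half evaded —
the route CONSUMES only the odd sector of the barrier's open input (ZeroCurrentRigidity, strictly
weaker than MacroErgodicityHypothesis: no classification of invariant states), which the barrier's
own scope_caveats single out as what the PINNED chain needs at Euler scale, and it never meets the
second half (one- /two-block estimates, sector condition, SectorCondition.eq_zero_of_symm_zero)
because no hydrodynamic limit is taken: compactness + parity reach the qualitative rung directly.
Honest: the rigidity itself is not evaded; the bet is that the odd sector is provable where the full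
characterisation is not.
- Literature.Barriers.AtomisticToContinuum.HasBoundedResponse: NOT evaded and not claimed —
BoundaryThermalisation (J̃_N = o(1) at fixed δT) is strictly weaker than bounded response (D_N =
O(1)); the route escapes the fixed-N trap only in that its cruxes are N-uniform / N-free statements;
filed openly as a rung that feeds the boundary-layer inputs of FourierGreenKubo.ThermodynamicLimit
(stmt-0742) and SuperadditiveJunction.NonBallistic (stmt-2192, soft way (b)).
- Literature.Barriers.AtomisticToContinuum.HarmonicChainBallisticFlux: consistent and used as
calibration — at lam = β = 0 NessTightness and NessRegularity hold (Gaussian steady states with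
N-uniform covariances), ZeroCurrentRigidity and Liouvil

History (route lifecycle, newest last):
- 2026-08-15T13:45:23Z · CLOSED retired — not-a-thesis: assembly does not conclude the sub-problem Statement (operator:999:1257524)

sub-problem: FouriersLaw · status: closed(retired) · opened planner-plancard-AtomisticToContinuum-Fourier-d26dd41f-0 2026-08-15T11:40:58Z · rev 0 · ledger route-AtomisticToContinuum-ParityLiouville
GENERATED by the gate from the ledger (D-0016/17). Provers cite these decls: `theorem foo : Summit.AtomisticToContinuum.FouriersLaw.Theses.ParityLiouville.<Decl> := …` in Summits/AtomisticToContinuum/FouriersLaw/Theorems/<Name>.lean.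
-/

namespace Summit.AtomisticToContinuum.FouriersLaw.Theses.ParityLiouville

open scoped BigOperators Topology Manifold Classical MeasureTheory ProbabilityTheory Matrix InnerProductSpace ComplexConjugate ContinuousMap
open Filter Set Function TopologicalSpace MeasureTheory

attribute [summit_statement] _root_.FouriersLaw

/-- item stmt-AtomisticToContinuum-3255 · target · rank 0 · closed · moot by None · by planner
why it might fail: Inherits the cruxes: a radiating regular state of the infinite anharmonic chain (hidden odd charge, KAM debris), N-growing NESS moments or entropies (energy/entropy piling up in a Hamiltonian bulk), or non-thermalising dilute radiation would break it.
sources: BonettoLebowitzReyBellet2000, SpohnLebowitz1977, BernardinOlla2011, AokiKusnezov2001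
[target] BOUNDARY THERMALISATION / FIRST RUNG at fixed temperatures: for pinnedChain ω₂ lam β γ (all
> 0), T_L, T_R > 0 and EVERY family (μ_N)_N of weak steady states (IsSteadyState; such families
exist: CuneoEckmannHairerReyBellet2018_pinnedChain_holds + isSteadyState_zero): ⟨p_0²⟩_{μ_{N+1}} →
T_L, ⟨p_N²⟩_{μ_{N+1}} → T_R (site Fin.last N) and J̃_N = totalCurrent(μ_N)/(N−1) → 0 as N → ∞ (N =
0, 1 give junk 0/finite terms, irrelevant to atTop). Open for every deterministic anharmonic chain;
FALSE for the harmonic chain (J̃_N → c_∞(T_L − T_R), HarmonicChainBallisticFlux_holds). Strictly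
weaker than HasBoundedResponse (no rate; δT fixed) — a rung, not the conjunct. Sources:
BonettoLebowitzReyBellet2000 §6.3/§9; BernardinOlla2011 Thm 3 (stochastic precedent);
AokiKusnezov2001 (boundary jumps shrink with N, numerics). -/
@[route_item "route-AtomisticToContinuum-ParityLiouville"]
def BoundaryThermalisation : Prop :=
  ∀ ω₂ lam β γ : ℝ, 0 < ω₂ → 0 < lam → 0 < β → 0 < γ → ∀ T_L T_R : ℝ, 0 < T_L → 0 < T_R → ∀ μ : (N : ℕ) → MeasureTheory.Measure (Literature.MathematicalPhysics.KineticTheory.HeatConduction.PhaseSpace N), (∀ N, (Literature.MathematicalPhysics.KineticTheory.HeatConduction.pinnedChain ω₂ lam β γ).IsSteadyState N T_L T_R (μ N)) → Filter.Tendsto (fun N : ℕ => ∫ x, (x.2 (0 : Fin (N + 1))) ^ 2 ∂(μ (N + 1))) Filter.atTop (nhds T_L) ∧ Filter.Tendsto (fun N : ℕ => ∫ x, (x.2 (Fin.last N)) ^ 2 ∂(μ (N + 1))) Filter.atTop (nhds T_R) ∧ Filter.Tendsto (fun N : ℕ => (Literature.MathematicalPhysics.KineticTheory.HeatConduction.pinnedChain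 ω₂ lam β γ).totalCurrent (μ N) / ((N : ℝ) - 1)) Filter.atTop (nhds 0)

/-- item stmt-AtomisticToContinuum-2739 · crux · rank 2 · closed · moot by None · by planner
why it might fail: Regular current-carrying invariant states may exist without integrability: KAM/breather families (FFL1994 p.215) or a hidden quasi-local odd conserved charge (Mazur); open for every anharmonic chain, and 'regular' does not exclude currents (harmonic case).
sources: FritzFunakiLebowitz1994, Bernardin2014, SpohnLebowitz1977, LiveraniOlla1996, Mazur1969, Zotos2002
[crux] ZERO-CURRENT (ODD-SECTOR) RIGIDITY OF THE INFINITE CHAIN: for ω₂, lam, β > 0 (γ inert), every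
probability measure ν on (ℝ×ℝ)^ℤ that is shift-invariant, time-invariant for the infinite
deterministic pinned chain in the generator sense (∫ 𝒜f dν = 0 for f ∈ C₀¹, 𝒜f ν-integrable) and
regular (relative entropy of every box marginal ≤ C|Λ| w.r.t. a Gibbs state) — decls
IsShiftInvariant / OscillatorChain.IsTimeInvariant / OscillatorChain.IsRegular of
Literature/Barriers/AtomisticToContinuum/MacroErgodicityHypothesis.lean — and integrates the bond
current j_0 = bondCurrentZ σ 0, has ∫ j_0 dν = 0. Strictly weaker than MacroErgodicityHypothesis (a
Gibbs mixture is invariant under p ↦ −p and j_0 is odd), it is exactly the Euler-scale input that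
MacroErgodicityBarrier's scope_caveats single out for the PINNED chain ('regular space-time
invariant states carry zero mean energy current'), implied also by site-wise reflection symmetry
(FFL1994 Thm 2.2 hypothesis), and false at lam = β = 0 (current-carrying stationary states of
infinite harmonic systems, SpohnLebowitz1977). By Gibbs tilting e^{εΣτ_xψ}μ_T it excludes every
tiltable (local or summable quasi-local) conserved charge overlapping -/
@[route_item "route-AtomisticToContinuum-ParityLiouville"]
def ZeroCurrentRigidity : Prop :=
  ∀ ω₂ lam β γ : ℝ, 0 < ω₂ → 0 < lam → 0 < β → ∀ ν : MeasureTheory.Measure Literature.MathematicalPhysics.KineticTheory.HeatConduction.ChainConfig, MeasureTheory.IsProbabilityMeasure ν → Literature.Barriers.AtomisticToContinuum.HeatConduction.IsShiftInvariant ν → (Literature.MathematicalPhysics.KineticTheory.HeatConduction.pinnedChain ω₂ lam β γ).IsTimeInvariant ν → (Literature.MathematicalPhysics.KineticTheory.HeatConduction.pinnedChain ω₂ lam β γ).IsRegular ν → MeasureTheory.Integrable (fun σ => (Literature.MathematicalPhysics.KineticTheory.HeatConduction.pinnedChain ω₂ lam β γ).bondCurrentZ σ 0) ν → ∫ σ,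 (Literature.MathematicalPhysics.KineticTheory.HeatConduction.pinnedChain ω₂ lam β γ).bondCurrentZ σ 0 ∂ν = 0

/-- item stmt-AtomisticToContinuum-5371 · crux · rank 3 · closed · moot by None · by planner
why it might fail: No N-uniform a priori estimate exists for a Hamiltonian-bulk NESS; entropy needs bulk Fisher-information control = quantitative hypoellipticity uniform in N, exactly what is missing (Villani2009 §9.2, BeckerMenegaki2022); a singular exotic weak steady state (NessUnique open) gives klDiv = ∞.
sources: Bernardin2014, EckmannPilletReyBellet1999b, BernardinOlla2005, BonettoLebowitzReyBellet2000, Villani2009, BeckerMenegaki2022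
[crux] N-UNIFORM REGULARITY OF THE NESS (card item M2; new typed crux): for pinnedChain (all
parameters > 0) and T_L, T_R > 0 there are a temperature T > 0, a SHIFT-INVARIANT infinite-volume
Gibbs state μ_T of the chain and C < ∞ such that for every N, every weak steady state μ of the
N-chain and every box Λ = {a, …, a+n} ⊆ {0, …, N−1}: H(μ|_Λ ‖ μ_T|_Λ) ≤ C·(n+1) (Mathlib klDiv of
the box marginals). The entropy twin of NessTightness: what makes window limits IsRegular, hence
inside the scope of macro-ergodicity. Expected via entropy balance (production = γΣ T_α × relative
Fisher information at the baths, EckmannPilletReyBellet1999b) + a dimension-free log-Sobolev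
inequality for the uniformly log-concave Gibbs reference + control of Fisher information in the
bulk; stochastic precedent BernardinOlla2005 (entropy of the NESS relative to local equilibrium,
harmonic chain + conservative noise). [difficulty: XL] -/
@[route_item "route-AtomisticToContinuum-ParityLiouville"]
def NessRegularity : Prop :=
  ∀ ω₂ lam β γ : ℝ, 0 < ω₂ → 0 < lam → 0 < β → 0 < γ → ∀ T_L T_R : ℝ, 0 < T_L → 0 < T_R → ∃ (T : ℝ) (μT : MeasureTheory.Measure Literature.MathematicalPhysics.KineticTheory.HeatConduction.ChainConfig), 0 < T ∧ (Literature.MathematicalPhysics.KineticTheory.HeatConduction.pinnedChain ω₂ lam β γ).IsChainGibbsMeasure T μT ∧ Literature.Barriers.AtomisticToContinuum.HeatConduction.IsShiftInvariant μT ∧ ∃ C : ENNReal, C ≠ ⊤ ∧ ∀ (N : ℕ) (μ : MeasureTheory.Measure (Literature.MathematicalPhysics.KineticTheory.HeatConduction.PhaseSpace N)), (Literature.MathematicalPhysics.KineticTheory.HeatConduction.pinnedChain ω₂ lam β γ).IsSteadyState N T_L T_R μ → ∀ (a n : ℕ) (h : a + (n + 1) ≤ N), InformationTheory.klDiv (μ.map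 (fun x => fun i : Fin (n + 1) => (x.1 (Fin.castLE h (Fin.natAdd a i)), x.2 (Fin.castLE h (Fin.natAdd a i))))) (Literature.Barriers.AtomisticToContinuum.HeatConduction.boxMarginal (a : ℤ) n μT) ≤ C * (n + 1)

/-- item stmt-AtomisticToContinuum-3257 · crux · rank 4 · closed · moot by None · by planner
why it might fail: No N-uniform moment bound is known for any Hamiltonian-bulk chain (Bernardin2014 §2: 'polynomial in N'); Lyapunov constants of CEHR2018 grow with N; stiff pinning heats tails (Hairer2009), pinnedChain is the borderline degree 4 = 4.
sources: Bernardin2014, CuneoEckmannHairerReyBellet2018, Hairer2009, HairerMattingly2009, EckmannPilletReyBellet1999b, BonettoLebowitzReyBellet2000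
[crux] N- AND SITE-UNIFORM MOMENT BOUNDS FOR THE NESS: for pinnedChain (all parameters > 0), T_L,
T_R > 0 and every m there is C = C(ω₂,lam,β,γ,T_L,T_R,m) such that for every N, every weak steady
state μ of the N-chain (IsSteadyState) and every site i: |q_i|^m + |p_i|^m is μ-integrable with ∫ ≤
C. Physically overwhelming (local states between T_R and T_L with Gaussian momentum and e^{-lam
q⁴/4T} position tails) but no N-uniform a priori estimate is known for any Hamiltonian-bulk chain:
the printed Lyapunov bounds (e^{ϑH} ∈ L¹, CuneoEckmannHairerReyBellet2018 Thm 2.13, in tree and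
proved for each N) have N-dependent constants. Needed with m = 4 for the compactness step (uniform
integrability of the cubic forces and of p_0²) and with all m to land in the tempered class of
NoFlux; shared in substance with card regular-or-radiating (NESSBulkRegularity(a)) and with every
boundary-layer argument of FourierGreenKubo.ThermodynamicLimit. Candidate engines: local energy
balance + bath dissipation identities (entropy production = γ Σ_α T_α × relative Fisher information
of the p_α-marginal, EckmannPilletReyBellet1999b; BonettoLebowitzReyBellet2000 §5.2),
maximum-principle statements for kineti -/
@[route_item "route-AtomisticToContinuum-ParityLiouville"]
def NessTightness : Prop :=
  ∀ ω₂ lam β γ : ℝ, 0 < ω₂ → 0 < lam → 0 < β → 0 < γ → ∀ T_L T_R : ℝ, 0 < T_L → 0 < T_R → ∀ m : ℕ, ∃ C : ℝ, ∀ (N : ℕ) (μ : MeasureTheory.Measure (Literature.MathematicalPhysics.KineticTheory.HeatConduction.PhaseSpace N)), (Literature.MathematicalPhysics.KineticTheory.HeatConduction.pinnedChain ω₂ lam β γ).IsSteadyState N T_L T_R μ → ∀ i : Fin N, MeasureTheory.Integrable (fun x => |x.1 i| ^ m + |x.2 i| ^ m) μ ∧ ∫ x, (|x.1 i| ^ m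 + |x.2 i| ^ m) ∂μ ≤ C

/-- item stmt-AtomisticToContinuum-3259 · support · rank 9 · closed · moot by None · by planner
sources: BonettoLebowitzReyBellet2000
[support] EXACT ENERGY BALANCE AT THE TWO CONTACTS (provable; any real parameters and temperatures):
for the (N+2)-site chain and a weak steady state μ all of whose polynomial coordinate moments are
finite, totalCurrent μ = (N+1)·γ·(T_L − ∫ p_0² dμ) = (N+1)·γ·(∫ p_{N+1}² dμ − T_R). Content: with
cutoffs as in HalfLineLimit, 0 = ∫ L(p_0²/2 + U(q_0)) dμ = ⟨p_0 V′(q_1 − q_0)⟩ + γ(T_L − ⟨p_0²⟩)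
(∂_{q_0}H = U′(q_0) − V′(q_1 − q_0)); 0 = ∫ L V(q_1 − q_0) dμ = ⟨(p_1 − p_0)V′(q_1 − q_0)⟩, so ⟨j_0⟩
= −½⟨(p_0 + p_1)V′⟩ = γ(T_L − ⟨p_0²⟩); the window energies H_k give ⟨j_k⟩ = ⟨j_0⟩ for every bond k ≤
N, the last index carries no bond (bondCurrent = 0), hence totalCurrent = (N+1)J̃; and 0 = ∫ L H dμ
= γ(T_L − ⟨p_0²⟩) + γ(T_R − ⟨p²_{N+1}⟩) (generator_hamiltonian) gives the right-end form. This is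
BLR's J̃ = γ(T_L − ⟨p_0²⟩) (BonettoLebowitzReyBellet2000 §5.2 (25)–(27)); it converts NoFlux-type
information into J̃_N → 0 and right-end thermalisation without any reflection argument. -/
@[route_item "route-AtomisticToContinuum-ParityLiouville"]
def ExactBalance : Prop :=
  ∀ (ω₂ lam β γ T_L T_R : ℝ) (N : ℕ) (μ : MeasureTheory.Measure (Literature.MathematicalPhysics.KineticTheory.HeatConduction.PhaseSpace (N + 2))), (Literature.MathematicalPhysics.KineticTheory.HeatConduction.pinnedChain ω₂ lam β γ).IsSteadyState (N + 2) T_L T_R μ → (∀ (m : ℕ) (i : Fin (N + 2)), MeasureTheory.Integrable (fun x => |x.1 i| ^ m + |x.2 i| ^ m) μ) → (Literature.MathematicalPhysics.KineticTheory.HeatConduction.pinnedChain ω₂ lam β γ).totalCurrent μ = (N + 1) * (γ * (T_L - ∫ x, (x.2 0) ^ 2 ∂μ)) ∧ (Literature.MathematicalPhysics.KineticTheory.HeatConduction.pinnedChain ω₂ lam β γ).totalCurrent μ = (N + 1) * (γ * (∫ x, (x.2 (Fin.last (N + 1))) ^ 2 ∂μ - T_R))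

/-- item stmt-AtomisticToContinuum-5372 · support · rank 9 · closed · moot by None · by planner
sources: SpohnLebowitz1977, FritzFunakiLebowitz1994, Bernardin2014
[support] LIOUVILLE THEOREM FOR HEAT (the card's M3, stand-alone deliverable; closed by
CesaroUpgrade + ZeroCurrentRigidity or directly): for ω₂, lam, β > 0, every probability measure ν on
(ℝ×ℝ)^ℤ that is time-invariant (IsTimeInvariant), translation-BOUNDED (all polynomial site moments
bounded uniformly in the site) and uniformly regular (box relative entropies ≤ C(n+1) w.r.t. one
shift-invariant Gibbs state), with j_0 integrable, has ∫ j_0 dν = 0 — NOT assuming shift-invariance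
of ν. 'Heat cannot flow steadily through an infinite thermalising medium'; false for the harmonic
chain (SpohnLebowitz1977 radiating states), printed as an expectation for anharmonic crystals
(SpohnLebowitz1977 §7 (iii)). [difficulty: open-problem] -/
@[route_item "route-AtomisticToContinuum-ParityLiouville"]
def LiouvilleForHeat : Prop :=
  ∀ ω₂ lam β γ : ℝ, 0 < ω₂ → 0 < lam → 0 < β → ∀ ν : MeasureTheory.Measure Literature.MathematicalPhysics.KineticTheory.HeatConduction.ChainConfig, MeasureTheory.IsProbabilityMeasure ν → (Literature.MathematicalPhysics.KineticTheory.HeatConduction.pinnedChain ω₂ lam β γ).IsTimeInvariant ν → (∀ m : ℕ, ∃ C : ℝ, ∀ x : ℤ, MeasureTheory.Integrable (fun σ => |(σ x).1| ^ m + |(σ x).2| ^ m) ν ∧ ∫ σ, (|(σ x).1| ^ m + |(σ x).2| ^ m) ∂ν ≤ C) → (∃ (T : ℝ) (μT : MeasureTheory.Measure Literature.MathematicalPhysics.KineticTheory.HeatConduction.ChainConfig), 0 < T ∧ (Literature.MathematicalPhysics.KineticTheory.HeatConduction.pinnedChain ω₂ lam β γ).IsChainGibbsMeasure T μT ∧ Literature.Barriers.AtomisticToContinuum.HeatConduction.IsShiftInvariant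 μT ∧ ∃ C : ENNReal, C ≠ ⊤ ∧ ∀ (a : ℤ) (n : ℕ), InformationTheory.klDiv (Literature.Barriers.AtomisticToContinuum.HeatConduction.boxMarginal a n ν) (Literature.Barriers.AtomisticToContinuum.HeatConduction.boxMarginal a n μT) ≤ C * (n + 1)) → MeasureTheory.Integrable (fun σ => (Literature.MathematicalPhysics.KineticTheory.HeatConduction.pinnedChain ω₂ lam β γ).bondCurrentZ σ 0) ν → ∫ σ, (Literature.MathematicalPhysics.KineticTheory.HeatConduction.pinnedChain ω₂ lam β γ).bondCurrentZ σ 0 ∂ν = 0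

/-- item stmt-AtomisticToContinuum-5373 · support · rank 9 · closed · moot by None · by planner
sources: Bernardin2014, KipnisLandim1999, LanfordLebowitzLieb1977
[support] GLUE (provable, ~1–2 weeks of Lean): ZeroCurrentRigidity → LiouvilleForHeat. Given ν as in
LiouvilleForHeat, ν_n := n⁻¹Σ_{k<n} (shift^k)_*ν is time-invariant (liouvilleZ commutes with shift;
the test class IsLocalTestFunction is shift-stable), has the same site-uniform moments and —
convexity of klDiv in the first argument, reference shift-invariant — the same regularity constant;
tightness (moments) gives a weak limit ν̄ along n_k: a shift-invariant probability measure,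
time-invariant (uniform integrability of 𝒜f from moments of order > 3, forces cubic), IsRegular
(lower semicontinuity of klDiv box by box, fixed reference), j_0 ∈ L¹. BOND-INDEPENDENCE: 𝒜e_k =
j_{k−1} − j_k for the local energy e_k = p_k²/2 + U(q_k) + V(q_{k+1} − q_k) (cut off through bounded
C¹ functions φ_M(e_k), dominated convergence) gives ν(j_k) = ν(j_0) for all k, so ν̄(j_0) = ν(j_0);
ZeroCurrentRigidity kills ν̄(j_0). [difficulty: M] -/
@[route_item "route-AtomisticToContinuum-ParityLiouville"]
def CesaroUpgrade : Prop :=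
  ZeroCurrentRigidity → LiouvilleForHeat

/-- item stmt-AtomisticToContinuum-5374 · support · rank 9 · closed · moot by None · by planner
sources: Bernardin2014, FritzFunakiLebowitz1994
[support] PARITY (provable-now): MacroErgodicityHypothesis → ZeroCurrentRigidity. Under the
hypothesis ν = π.bind κ with κ_T Gibbs (IsGibbsMixture); ∫ j_0 dν = ∫(∫ j_0 dκ_T) dπ (integrability
along the bind); for a DLR state κ_T the two-site kernel of chainSpecification at {0,1} resamples
(p_0, p_1) as centred Maxwellians independent of the positions (cf.
InfiniteChainGibbsMomenta.map_snd_eq_gaussianReal), and j_0 = −½(p_0 + p_1)V′(q_1 − q_0) is odd in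
(p_0, p_1), so ∫ j_0 dκ_T = 0. Makes the catalogued hypothesis a sufficient engine for crux 2
verbatim (planner one-liner zeroCurrent_of_hypothesis in Sketch.lean). [difficulty: provable-now] -/
@[route_item "route-AtomisticToContinuum-ParityLiouville"]
def ZeroCurrentOfMacroErgodic : Prop :=
  Literature.Barriers.AtomisticToContinuum.MacroErgodicityHypothesis → ZeroCurrentRigidity

/-- item stmt-AtomisticToContinuum-5375 · support · rank 9 · closed · moot by None · by planner
sources: EyinkLebowitzSpohn1991, LanfordLebowitzLieb1977, KipnisLandim1999, SpohnLebowitz1977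
[support] BULK WINDOW COMPACTNESS (provable; no sign conditions needed): for any real parameters and
any family (μ_N) of weak steady states with site-uniform moments (the NessTightness shape) and
uniform regularity w.r.t. a shift-invariant Gibbs reference (the NessRegularity shape), if for some
ε > 0 frequently ε ≤ |totalCurrent(μ_N)/(N−1)|, then there is a probability measure ν on (ℝ×ℝ)^ℤ
that is time-invariant (IsTimeInvariant), translation-bounded, uniformly regular w.r.t. the same
reference, with j_0 integrable and ε ≤ |∫ j_0 dν|. Proof: read μ_N on windows centred at ⌊N/2⌋
(zero-padded push-forward to ChainConfig); Prokhorov; STATIONARITY TRANSFER: for a local C¹ test f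
the bath terms of the generator do not touch bulk coordinates, so L_N(f∘window) = (𝒜f)∘window, and ∫
L_N(f∘window·χ_M) dμ_N = 0 with smooth cutoffs χ_M (mollify f to C^∞; let M → ∞ by dominated
convergence at fixed N); pass N → ∞ by uniform integrability (moments > 3); regularity by lower
semicontinuity of klDiv with the shift-invariant reference; all bond currents of a steady state
equal J̃_N (local energy balance with cutoffs), currents uniformly integrable (moments > 4), so ∫
j_0 dν = lim J̃_{N_k} with |lim| -/
@[route_item "route-AtomisticToContinuum-ParityLiouville"]
def WindowLimit : Prop :=
  ∀ (ω₂ lam β γ T_L T_R : ℝ) (μ : (N : ℕ) → MeasureTheory.Measure (Literature.MathematicalPhysics.KineticTheory.HeatConduction.PhaseSpace N)), (∀ N, (Literature.MathematicalPhysics.KineticTheory.HeatConduction.pinnedChain ω₂ lam β γ).IsSteadyState N T_L T_R (μ N)) → (∀ m : ℕ, ∃ C : ℝ, ∀ (N : ℕ) (i : Fin N), MeasureTheory.Integrable (fun x => |x.1 i| ^ m + |x.2 i| ^ m) (μ N) ∧ ∫ x, (|x.1 i| ^ m + |x.2 i| ^ m) ∂(μ N) ≤ C) → (∃ (T : ℝ)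 (μT : MeasureTheory.Measure Literature.MathematicalPhysics.KineticTheory.HeatConduction.ChainConfig), 0 < T ∧ (Literature.MathematicalPhysics.KineticTheory.HeatConduction.pinnedChain ω₂ lam β γ).IsChainGibbsMeasure T μT ∧ Literature.Barriers.AtomisticToContinuum.HeatConduction.IsShiftInvariant μT ∧ ∃ C : ENNReal, C ≠ ⊤ ∧ ∀ (N : ℕ) (a n : ℕ) (h : a + (n + 1) ≤ N), InformationTheory.klDiv ((μ N).map (fun x => fun i : Fin (n + 1) => (x.1 (Fin.castLE h (Fin.natAdd a i)), x.2 (Fin.castLE h (Fin.natAdd a i))))) (Literature.Barriers.AtomisticToContinuum.HeatConduction.boxMarginal (a : ℤ) n μT) ≤ C * (n + 1)) → ∀ ε : ℝ, 0 < ε → (∃ᶠ N in Filter.atTop, ε ≤ |(Literature.MathematicalPhysics.KineticTheory.HeatConduction.pinnedChain ω₂ lam β γ).totalCurrent (μ N) / ((N : ℝ) - 1)|) → ∃ ν : MeasureTheory.Measure Literature.MathematicalPhysics.KineticTheory.HeatConduction.ChainConfig, MeasureTheory.IsProbabilityMeasure ν ∧ (Literature.MathematicalPhysics.KineticTheory.HeatConduction.pinnedChain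 ω₂ lam β γ).IsTimeInvariant ν ∧ (∀ m : ℕ, ∃ C : ℝ, ∀ x : ℤ, MeasureTheory.Integrable (fun σ => |(σ x).1| ^ m + |(σ x).2| ^ m) ν ∧ ∫ σ, (|(σ x).1| ^ m + |(σ x).2| ^ m) ∂ν ≤ C) ∧ (∃ (T : ℝ) (μT : MeasureTheory.Measure Literature.MathematicalPhysics.KineticTheory.HeatConduction.ChainConfig), 0 < T ∧ (Literature.MathematicalPhysics.KineticTheory.HeatConduction.pinnedChain ω₂ lam β γ).IsChainGibbsMeasure T μT ∧ Literature.Barriers.AtomisticToContinuum.HeatConduction.IsShiftInvariant μT ∧ ∃ C : ENNReal, C ≠ ⊤ ∧ ∀ (a : ℤ) (n : ℕ), InformationTheory.klDiv (Literature.Barriers.AtomisticToContinuum.HeatConduction.boxMarginal a n ν) (Literature.Barriers.AtomisticToContinuum.HeatConduction.boxMarginal a n μT) ≤ C * (n + 1)) ∧ MeasureTheory.Integrable (fun σ => (Literature.MathematicalPhysics.KineticTheory.HeatConduction.pinnedChain ω₂ lam β γ).bondCurrentZ σ 0) ν ∧ ε ≤ |∫ σ, (Literature.MathematicalPhysics.KineticTheory.HeatConduction.pinnedChain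 ω₂ lam β γ).bondCurrentZ σ 0 ∂ν|

/-- item stmt-AtomisticToContinuum-5376 · assembly · rank 1 · closed · moot by None · by planner
sources: BonettoLebowitzReyBellet2000, EyinkLebowitzSpohn1991, SpohnLebowitz1977
[assembly] NessTightness → NessRegularity → ZeroCurrentRigidity → WindowLimit → CesaroUpgrade →
ExactBalance → BoundaryThermalisation (target of this rung route; proved composable in Sketch.lean). -/
@[route_item "route-AtomisticToContinuum-ParityLiouville"]
def Assembly : Prop :=
  NessTightness → NessRegularity → ZeroCurrentRigidity → WindowLimit → CesaroUpgrade → ExactBalance → BoundaryThermalisation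

end Summit.AtomisticToContinuum.FouriersLaw.Theses.ParityLiouville
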